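import Literature.NumberTheory.Transcendental.LWMeasureSmallTermsEps
import Literature.NumberTheory.Transcendental.LWMeasureSmallTermMax
import Literature.NumberTheory.Transcendental.LWMeasureFamilySizes
import Literature.NumberTheory.Transcendental.LWMeasureZeroFreeFinal
import Literature.NumberTheory.Transcendental.LWMeasureMainPropArith
import HarnessLib

/-!
# The Lindemann–Weierstrass measure (Ably 1994, §II) — the "Proposition principale" assembled

`Literature/NumberTheory/Transcendental/LWMeasureMainProp.lean` — proofs only (no definitions,
no named facts, nothing asserted). Last step of §II of M. Ably, *Une version quantitative du
théorème de Lindemann–Weierstrass*, Acta Arith. 67 (1994) 29–45 ("Choix des paramètres et preuve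
de la proposition principale", pp. 40–41) behind the named fact
`Ably1994_lindemannWeierstrass_measure` (`LindemannWeierstrassMeasure.lean`), in the tree's
`ℚ`-setting of `LWMeasureConstruction.lean` (one extra letter `w` for the integral generator `α`
of `ℚ(y)`):

* `LWMeasure.mainProp` — for the data `S : Setup` there are `M₀` and constants `cE, cδ, cτ > 0`
  such that for every `M ≥ M₀` and every real scale `R ≥ exp(cE Mⁿ log M)` there is a finite family
  `Q_i ∈ ℤ[w, X₁, …, Xₙ]` with `deg Q_i ≤ cδ M`, `log ‖Q_i‖₁ ≤ cτ R / Mⁿ`,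
  `|Q_i(α, e^{y₁}, …, e^{yₙ})| ≤ e^{−R}` and without common zero in the polydisc of radius
  `e^{−2R}` about `(α, e^{y})` — the shape consumed by the affine quantitative criterion
  (`QuantCIA.exists_const_affine_measure`, `LWMeasureTheorem.lean`); this is Ably's
  Proposition principale (p. 33: (i) no zeros in the ball of radius `exp(−r₁(L))`, (ii) values
  `≤ exp(−r_{1/2}(L))`, (iii) `deg ≤ δ_{c₄}(L, ν)`, `h ≤ H_{c₅}(L, ν)`) re-parametrised by
  `(M, R)`: `Mⁿ` plays `(log L)^ν`, `R = ½ r₁(L)`, and conditions (1)–(3) p. 33 become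
  `M ≥ M₀`, `R ≥ exp(cE Mⁿ log M)`.

The family is `{μ(w)} ∪ {Q_{s,h,j} : s < T, h ∈ [0,M)ⁿ, j ∈ J}` where `p` comes from Siegel's
step (`Setup.exists_coeffs`, (C₁) with `D = 2^{n+4} d` frequencies, box `b = DM`, order
`T' = ⌊8L/Mⁿ⌋`), `J` is Diaz's set of minimal Taylor indices at points of the polydisc (members
with `j ∉ J` are replaced by `0`), `T = ⌊2^{n+1} c_z L D/Mⁿ⌋ + 1` makes (C₃), (C₄) hold, and `L` is
the least integer with `R ≤ (5/4) L log L`. Smallness is `Setup.norm_aeval_Qj_le_composite` split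
as `Setup.small_terms_eps + Setup.small_term_max`, sizes are `Setup.family_sizes`, zero-freeness is
root separation for `μ` (pinning `w = α`) followed by `Setup.no_common_zero_near` at the zero's
own minimal index (Ably, Lemme 3 and the set `I_r`, p. 36).

## References

* [Ably1994] M. Ably, *Une version quantitative du théorème de Lindemann–Weierstrass*, Acta Arith.
  67 (1994) 29–45, §II, Proposition principale (p. 33) and its proof (pp. 40–41).
* [Diaz1989] G. Diaz, *Grands degrés de transcendance pour des familles d'exponentielles*,
  J. Number Theory 31 (1989), §II-3 (the modification and the set of minimal indices).
-/

noncomputable section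

open scoped Polynomial
open MvPolynomial Finset Finsupp Complex

namespace Literature.NumberTheory.Transcendental

namespace LWMeasure

namespace Setup

/-- **Proposition principale (Ably 1994, §II, p. 33), assembled in the `(M, R)`-parametrisation.**
For the data `S` (algebraic `ℚ`-linearly independent `y₁, …, yₙ`, integral generator `α`) there
are `M₀` and `cE, cδ, cτ > 0` such that for all `M ≥ M₀` and all real `R ≥ exp(cE Mⁿ log M)`
there is a finite family `Q_i ∈ ℤ[w, X₁, …, Xₙ]` with (iii) `deg Q_i ≤ cδ M`,
`log ‖Q_i‖₁ ≤ cτ R/Mⁿ`, (ii) `|Q_i(α, e^{y})| ≤ e^{−R}`, (i) no common zero within `e^{−2R}` of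
`(α, e^{y})`. [cite: Ably1994, §II Proposition principale p. 33 and pp. 40–41] -/
theorem mainProp (S : Setup) :
    ∃ (M₀ : ℕ) (cE cδ cτ : ℝ), 0 < cE ∧ 0 < cδ ∧ 0 < cτ ∧
      ∀ (M : ℕ), M₀ ≤ M → ∀ (R : ℝ), Real.exp (cE * (M : ℝ) ^ S.n * Real.log (M : ℝ)) ≤ R →
        ∃ (ι : Type) (_ : Fintype ι) (Q : ι → MvPolynomial (Fin (S.n + 1)) ℤ),
          (∀ i, ((Q i).totalDegree : ℝ) ≤ cδ * M) ∧
          (∀ i, Real.log (Chudnovsky.l1 (Q i)) ≤ cτ * R / (M : ℝ) ^ S.n) ∧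
          (∀ i, ‖MvPolynomial.aeval (Fin.cons S.α S.θ : Fin (S.n + 1) → ℂ) (Q i)‖ ≤ Real.exp (-R)) ∧
          ∀ x : Fin (S.n + 1) → ℂ,
            (∀ k, ‖x k - (Fin.cons S.α S.θ : Fin (S.n + 1) → ℂ) k‖ < Real.exp (-(2 * R))) →
            ∃ i, MvPolynomial.aeval x (Q i) ≠ 0 := by
  classical
  -- the constants of the four ingredients
  obtain ⟨cz, r₀, k₀, hk₀, hZF⟩ := S.no_common_zero_near
  obtain ⟨cS, kS, hcS, hcS1, hsepM⟩ := S.exists_separated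
  obtain ⟨εsep, hεsep, hroot⟩ := exists_root_separation S.μ S.μ_monic.ne_zero S.α
  set D₀ : ℕ := 2 ^ (S.n + 4) * S.d with hD₀
  set cST : ℕ := 2 ^ (S.n + 1) * cz * D₀ + 1 with hcST
  obtain ⟨M₁, hW1⟩ := S.small_terms_eps cST kS hcS hcS1
  obtain ⟨M₂, hW2⟩ := S.small_term_max cST
  obtain ⟨M₃, cδ, cτ, hcδ, hcτ, hW3⟩ := S.family_sizes cST
  -- the threshold constant
  set cρ : ℝ := 1 + ∑ k, ‖S.y k‖ with hcρ
  set Kc : ℝ := |r₀| + k₀ * |Real.log (D₀ : ℝ)| + |Real.log εsep| + 1 with hKc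
  have hsum0 : 0 ≤ ∑ k, ‖S.y k‖ := sum_nonneg fun _ _ => norm_nonneg _
  have hcρ1 : 1 ≤ cρ := by rw [hcρ]; linarith only [hsum0]
  have habs1 : 0 ≤ |r₀| := abs_nonneg _
  have habs2 : 0 ≤ |Real.log (D₀ : ℝ)| := abs_nonneg _
  have habs3 : 0 ≤ |Real.log εsep| := abs_nonneg _
  have hk₀abs : 0 ≤ k₀ * |Real.log (D₀ : ℝ)| := mul_nonneg hk₀ habs2
  have hKc0 : 0 ≤ Kc := by rw [hKc]; linarith only [habs1, hk₀abs, habs3]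
  set M₄ : ℕ := ⌈Kc⌉₊ + ⌈4 * (1 + k₀)⌉₊ + ⌈cρ⌉₊ + 3 with hM₄
  refine ⟨M₁ + M₂ + M₃ + M₄, 10, cδ, cτ, by norm_num, hcδ, hcτ, ?_⟩
  intro M hM R hR
  -- sizes of `M` and `R`
  have hM1 : M₁ ≤ M := by omega
  have hM2 : M₂ ≤ M := by omega
  have hM3 : M₃ ≤ M := by omega
  have hM3' : 3 ≤ M := by omega
  have hM0R : (0 : ℝ) < M := by exact_mod_cast (show 0 < M by omega)
  have hM₄M : ((M₄ : ℕ) : ℝ) ≤ M := by exact_mod_cast (show M₄ ≤ M by omega)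
  have hM₄R : ((M₄ : ℕ) : ℝ) = (⌈Kc⌉₊ : ℝ) + ⌈4 * (1 + k₀)⌉₊ + ⌈cρ⌉₊ + 3 := by
    rw [hM₄]; push_cast; ring
  have hc1 := Nat.le_ceil Kc
  have hc2 := Nat.le_ceil (4 * (1 + k₀))
  have hc3 := Nat.le_ceil cρ
  have hc1' : (0 : ℝ) ≤ ⌈Kc⌉₊ := Nat.cast_nonneg _
  have hc2' : (0 : ℝ) ≤ ⌈4 * (1 + k₀)⌉₊ := Nat.cast_nonneg _
  have hc3' : (0 : ℝ) ≤ ⌈cρ⌉₊ := Nat.cast_nonneg _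
  have hKcM : Kc ≤ M := by linarith only [hc1, hM₄M, hM₄R, hc2', hc3']
  have hkM : 4 * (1 + k₀) ≤ (M : ℝ) := by linarith only [hc2, hM₄M, hM₄R, hc1', hc3']
  have hcρM : cρ + 2 ≤ (M : ℝ) := by linarith only [hc3, hM₄M, hM₄R, hc1', hc2']
  obtain ⟨hR2, hRM, hRK⟩ := thresholds (n := S.n) S.one_le_n hM3' hKcM hk₀ hkM hR
  have hR0 : 0 ≤ R := by linarith only [hR2]
  -- the choice of `L` and its consequences
  obtain ⟨L, hL3, hRL, hLR⟩ := exists_L hR2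
  obtain ⟨hMLR, hMnL, hMML⟩ := params_of_R hM3' hL3 hR hRL hLR
  have hL1 : 1 ≤ L := by omega
  have hMMn : M ≤ M ^ S.n := by
    calc M = M ^ 1 := (pow_one M).symm
      _ ≤ M ^ S.n := Nat.pow_le_pow_right (by omega) S.one_le_n
  have hML : M ≤ L := hMMn.trans hMnL
  -- parameters
  set P : ℕ := M ^ S.n with hP
  have hPpos : 0 < P := lt_of_lt_of_le (by omega) hMMn
  set T' : ℕ := 8 * L / P with hT'
  obtain ⟨hT'8, hT'7, hT'1⟩ := T'_bounds hPpos hMnL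
  set b : ℕ := D₀ * M with hb
  set T : ℕ := 2 ^ (S.n + 1) * cz * L * D₀ / P + 1 with hT
  have hD₀2 : 2 ≤ D₀ := by
    have h1 : 2 ≤ 2 ^ (S.n + 4) := by
      calc 2 = 2 ^ 1 := rfl
        _ ≤ 2 ^ (S.n + 4) := Nat.pow_le_pow_right (by norm_num) (by omega)
    calc 2 = 2 * 1 := rfl
      _ ≤ 2 ^ (S.n + 4) * S.d := Nat.mul_le_mul h1 S.one_le_d
  have hD₀1 : 1 ≤ D₀ := by omega
  have hb1 : 1 ≤ b := Nat.mul_pos (by omega) (by omega)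
  obtain ⟨hB1, hB2, hTz1, hC3, hC4, hsT⟩ :=
    zero_estimate_conditions (cz := cz) (D := D₀) S.one_le_n hM3' hML hMnL
  -- Siegel's step
  have hC1 : 2 * (M ^ S.n * (T' * (S.d * (b + D₀ * M) ^ S.n))) ≤ L * D₀ * b ^ S.n :=
    siegel_condition hT'8
  obtain ⟨p, hp0, hpH, hQ0⟩ := S.exists_coeffs (L := L) (D := D₀) (b := b) (M := M) (T' := T')
    hL1 hD₀1 hT'1 (by omega) hC1
  set H : ℝ := ((L * D₀ * b ^ S.n : ℕ) : ℝ) * (((L : ℝ) + D₀) ^ T' * S.K₁ M ^ L) with hH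
  have hpH' : ∀ w, |(p w : ℝ)| ≤ H := by
    intro w; have := hpH w; rwa [S.card_Unk] at this
  have hK0 : 0 ≤ S.K₁ M := zero_le_one.trans (S.one_le_K₁ M)
  have hH0 : 0 ≤ H :=
    mul_nonneg (Nat.cast_nonneg _) (mul_nonneg (pow_nonneg (by positivity) _) (pow_nonneg hK0 _))
  -- the separation and the radii
  set δ : ℝ := cS / ((S.n : ℝ) * M) ^ kS with hδ
  have hnM1 : (1 : ℝ) ≤ (S.n : ℝ) * M := by
    have h1 : (1 : ℝ) ≤ S.n := by exact_mod_cast S.one_le_n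
    have h2 : (1 : ℝ) ≤ M := by exact_mod_cast (show 1 ≤ M by omega)
    exact one_le_mul_of_one_le_of_one_le h1 h2
  have hpowpos : 0 < ((S.n : ℝ) * M) ^ kS := pow_pos (lt_of_lt_of_le one_pos hnM1) _
  have hδpos : 0 < δ := div_pos hcS hpowpos
  have hδ1 : δ ≤ 1 := by
    rw [hδ, div_le_one hpowpos]
    exact hcS1.trans (one_le_pow₀ hnM1)
  have hsep : DiazThm1.Separated S.y M δ := hsepM M (by omega)
  have hε1 : Real.exp (-(2 * R)) ≤ 1 := by rw [Real.exp_le_one_iff]; linarith only [hR0]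
  have hRc : ptsRad S.y M + 2 ≤ (L : ℝ) := by
    have h1 := S.ptsRad_le (M := M) (by omega)
    have h3 : (M : ℝ) * (cρ + 2) ≤ M * M := mul_le_mul_of_nonneg_left hcρM hM0R.le
    have h4 : (1 : ℝ) ≤ M := by exact_mod_cast (show 1 ≤ M by omega)
    have h5 : (M : ℝ) * (1 + ∑ k, ‖S.y k‖) = M * cρ := by rw [hcρ]
    linarith only [h1, h3, h4, h5, hMML]
  -- the set of good indices and the family
  set N : ℕ := S.n * (b - 1) with hN
  let jOf : (Fin (S.n + 1) → Fin (N + 1)) → (Fin (S.n + 1) →₀ ℕ) := fun v =>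
    Finsupp.equivFunOnFinite.symm fun i => ((v i : ℕ))
  let Good : (Fin (S.n + 1) →₀ ℕ) → Prop := fun j =>
    ∃ z : Fin S.n → ℂ, (∀ k, ‖z k - S.θ k‖ ≤ Real.exp (-(2 * R))) ∧ S.IsMinIdx p (Fin.cons S.α z) j
  let ι : Type := (Fin T × (Fin S.n → Fin M) × (Fin (S.n + 1) → Fin (N + 1))) ⊕ Unit
  let Q : ι → MvPolynomial (Fin (S.n + 1)) ℤ := Sum.elim
    (fun t => if Good (jOf t.2.2) then S.Qj p (natOf t.2.1) (t.1 : ℕ) (jOf t.2.2) else 0)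
    (fun _ => toW S.n S.μ)
  have hQl : ∀ t : Fin T × (Fin S.n → Fin M) × (Fin (S.n + 1) → Fin (N + 1)),
      Q (Sum.inl t) = if Good (jOf t.2.2) then S.Qj p (natOf t.2.1) (t.1 : ℕ) (jOf t.2.2) else 0 :=
    fun _ => rfl
  have hQr : ∀ u : Unit, Q (Sum.inr u) = toW S.n S.μ := fun _ => rfl
  have hcδM : (0 : ℝ) ≤ cδ * M := mul_nonneg hcδ.le hM0R.le
  have hcτR : (0 : ℝ) ≤ cτ * R / (M : ℝ) ^ S.n := div_nonneg (mul_nonneg hcτ.le hR0) (pow_nonneg hM0R.le _)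
  have hexp0 : (0 : ℝ) ≤ Real.exp (-R) := (Real.exp_pos _).le
  -- sizes of the members
  have hsizes : ∀ (s : ℕ) (h : Fin S.n → Fin M) (j : Fin (S.n + 1) →₀ ℕ), s * M ^ S.n ≤ cST * L →
      ((S.Qj p (natOf h) s j).totalDegree : ℝ) ≤ cδ * M ∧
      Real.log (Chudnovsky.l1 (S.Qj p (natOf h) s j)) ≤ cτ * R / (M : ℝ) ^ S.n ∧
      ((toW S.n S.μ).totalDegree : ℝ) ≤ cδ * M ∧
      Real.log (Chudnovsky.l1 (toW S.n S.μ)) ≤ cτ * R / (M : ℝ) ^ S.n :=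
    fun s h j hs => hW3 L D₀ b M T' s p (natOf h) j H R hM3 hMnL hD₀1 le_rfl hb1 le_rfl hT'8 hT'7 hs
      hMLR hRL hLR hH0 le_rfl hpH' (fun k => natOf_lt h k)
  have hs0 : 0 * M ^ S.n ≤ cST * L := by simp
  refine ⟨ι, inferInstance, Q, ?_, ?_, ?_, ?_⟩
  · -- (iii) degrees
    rintro (⟨s, h, v⟩ | u)
    · rw [hQl]
      split_ifs with hg
      · exact (hsizes s h (jOf v) (hsT s s.isLt)).1
      · rw [totalDegree_zero, Nat.cast_zero]; exact hcδM
    · rw [hQr]; exact (hsizes 0 (fun _ => ⟨0, by omega⟩) 0 hs0).2.2.1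
  · -- (iii) heights
    rintro (⟨s, h, v⟩ | u)
    · rw [hQl]
      split_ifs with hg
      · exact (hsizes s h (jOf v) (hsT s s.isLt)).2.1
      · have h0 : Chudnovsky.l1 (0 : MvPolynomial (Fin (S.n + 1)) ℤ) = 0 := Chudnovsky.wnorm_zero _
        rw [h0, Real.log_zero]; exact hcτR
    · rw [hQr]; exact (hsizes 0 (fun _ => ⟨0, by omega⟩) 0 hs0).2.2.2
  · -- (ii) smallness
    rintro (⟨s, h, v⟩ | u)
    · rw [hQl]
      split_ifs with hg
      · obtain ⟨z, hz, hj⟩ := hg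
        have hcomp := S.norm_aeval_Qj_le_composite hL1 p hH0 hpH' (by omega) hsep hδpos hδ1 hQ0
          (Real.exp_pos _).le hε1 hz hj hRc (fun k => natOf_lt h k) (s : ℕ)
        have h1 := hW1 L D₀ b M T' s δ H R hM1 hMnL hD₀1 le_rfl hb1 le_rfl hT'8 hT'7 (hsT s s.isLt)
          hMLR hRL hLR hH0 le_rfl hδpos hδ1 le_rfl
        have h2 := hW2 L D₀ b M T' s H R hM2 hMnL hD₀1 le_rfl hb1 le_rfl hT'8 hT'7 (hsT s s.isLt)
          hMLR hRL hLR hH0 le_rfl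
        refine hcomp.trans ?_
        have key := add_le_add h1 h2
        rw [add_halves] at key
        refine le_trans (le_of_eq ?_) key
        ring
      · rw [map_zero, norm_zero]; exact hexp0
    · rw [hQr, aeval_cons_toW, S.μ_root, norm_zero]; exact hexp0
  · -- (i) no common zero near `(α, e^{y})`
    intro x hx
    by_contra hall
    push Not at hall
    -- `w = α` by root separation
    have hx0 : x 0 = S.α := by
      have h1 := hall (Sum.inr ())
      rw [hQr, ← Fin.cons_self_tail x, aeval_cons_toW] at h1
      refine hroot (x 0) h1 (lt_of_lt_of_le (b := Real.exp (-(2 * R))) ?_ ?_)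
      · have := hx 0
        rwa [Fin.cons_zero] at this
      · -- `exp(−2R) ≤ εsep`
        have hle : -(2 * R) ≤ Real.log εsep := by
          have h2 := neg_abs_le (Real.log εsep)
          have h3 : Kc + k₀ * M ≤ R := hRK
          have h4 : 0 ≤ k₀ * M := mul_nonneg hk₀ hM0R.le
          rw [hKc] at h3
          linarith only [h2, h3, h4, habs1, hk₀abs, hR0]
        calc Real.exp (-(2 * R)) ≤ Real.exp (Real.log εsep) := Real.exp_le_exp.2 hle
          _ = εsep := Real.exp_log hεsep
    set z : Fin S.n → ℂ := Fin.tail x with hzdef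
    have hxz : x = Fin.cons S.α z := by rw [← hx0, hzdef, Fin.cons_self_tail]
    have hz : ∀ k, ‖z k - S.θ k‖ ≤ Real.exp (-(2 * R)) := fun k => by
      have := hx k.succ
      rw [Fin.cons_succ] at this
      exact le_of_lt this
    -- the minimal index at the zero itself
    obtain ⟨j₀, hj₀⟩ := S.exists_isMinIdx hp0 (Fin.cons S.α z)
    have hdeg : degree j₀ ≤ N := S.degree_le_of_isMinIdx hj₀
    let v₀ : Fin (S.n + 1) → Fin (N + 1) := fun i =>
      ⟨j₀ i, Nat.lt_succ_of_le ((le_degree i j₀).trans hdeg)⟩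
    have hv₀ : jOf v₀ = j₀ := by
      ext i
      exact equivFunOnFinite_symm_apply_val v₀ i
    have hgood : Good (jOf v₀) := by rw [hv₀]; exact ⟨z, hz, hj₀⟩
    -- all `Q_{s,h,j₀}` vanish at `(α, z)`
    have hvan : ∀ h : Fin S.n → ℕ, (∀ k, h k < M) → ∀ s < T,
        MvPolynomial.aeval (Fin.cons S.α z : Fin (S.n + 1) → ℂ) (S.Qj p h s j₀) = 0 := by
      intro h hh s hs
      have h1 := hall (Sum.inl (⟨s, hs⟩, fun k => ⟨h k, hh k⟩, v₀))
      rw [hQl, if_pos hgood, hv₀, hxz] at h1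
      exact h1
    -- the threshold `r₀ + k₀ log(D₀ M) ≤ 2R`
    have hr : r₀ + k₀ * Real.log ((D₀ : ℝ) * M) ≤ 2 * R := by
      have hD0 : (0 : ℝ) < D₀ := by exact_mod_cast (show 0 < D₀ by omega)
      have hlogM : Real.log (M : ℝ) ≤ M := (Real.log_le_sub_one_of_pos hM0R).trans (by linarith only)
      rw [Real.log_mul hD0.ne' hM0R.ne']
      have h1 := le_abs_self r₀
      have h2 := le_abs_self (Real.log (D₀ : ℝ))
      have h3 : k₀ * Real.log (D₀ : ℝ) ≤ k₀ * |Real.log (D₀ : ℝ)| := mul_le_mul_of_nonneg_left h2 hk₀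
      have h4 : k₀ * Real.log (M : ℝ) ≤ k₀ * M := mul_le_mul_of_nonneg_left hlogM hk₀
      have h5 : Kc + k₀ * M ≤ R := hRK
      rw [hKc] at h5
      linarith only [h1, h3, h4, h5, habs3, hR0]
    exact hZF L D₀ b M T ((M - 1) / 2) ((T - 1) / 2) p z j₀ (2 * R) (by omega) hD₀2 hB1 hB2 hTz1 hC3
      hC4 hr hz hj₀ hvan

end Setup

end LWMeasure

end Literature.NumberTheory.Transcendental

end
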